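import Summits.CriticalPhenomena.PercolationContinuityZ3.Theorems.Transplant.FKDoubleFanOneSided
import HarnessLib

/-!
# Double fans, one-sided far pairs: the FLOOR × FLOOR × FLOOR endpoint of LEMMA′ — `fanPhi ≥ 0` when all three legs are at their floor points

Helper file (`--supports stmt-CriticalPhenomena-4575`), FK sub-lane `prim-bschramm-fk-3` (gen 31); builds on p205010 (kernel theorem, internal audit signed;
external expert review pending).  Pure real algebra, no sorries; standard axioms.  Memo `bschramm/prim-bschramm-fk-3/FAR-CROSS-VI.md` §10(j),(n).

The one-sided far theorem is reduced (`…DoubleFanOneSided`, `…CrossFarOneSided`) to LEMMA′: `fanPhi q F u s ≥ 0` for `F, u, s ∈ Valid ∧ U`.  By fibre linearity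
(`…OneSidedFibre`) each leg is a convex combination, along its apex fibre, of a FLOOR point (the fibre coordinate `Z₀` set to `0`) and a ROOF point (U-tight),
so LEMMA′ follows from the eight endpoint inequalities {floor, roof}³.  This file proves the first of them, **`fanPhi_floor_floor_floor_nonneg`**: for
`F = (0, f_ab, f_ac, f_bc, f₁)`, `u = (0, X, y, Z, r)`, `s = (0, X', Y', z', r')` with all entries `≥ 0` and `0 ≤ q ≤ 1`, `fanPhi q F u s ≥ 0`, through the
explicit decomposition **`fanPhi_floor_floor_floor_eq`** (`p = 1−q`, `V = |u|`, `V' = |s|`):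
`Φ = p·A·(f_ac² + f_ac f₁ + f_ac f_bc) + p·N·Y'V'·(f_bc² + f₁ f_bc + f_ac f_bc) + f_ac f_ab·[pXX'(VV' − p y z') + p²ZVX'z' + p²yZY'z']
   + f_ab f_bc·[pZY'(VV' − p y z') + p²XyY'V' + p²XVX'V']`, `A = XVX'V' + p yZY'z'`, `N = ZV + pXy`, where `VV' ≥ yz' ≥ p y z'`.
(Floor points are in general NOT valid vectors; only the signs of their coordinates are used, as in `…CrossApexInKE`.)
[folklore]
-/

noncomputable section

namespace Summit.CriticalPhenomena.PercolationContinuityZ3.Theorems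

namespace FK

namespace ThreeApex

/-- **The FFF decomposition** of `fanPhi` at floor points of all three legs. [folklore] -/
theorem fanPhi_floor_floor_floor_eq (q fab fac fbc f1 X y Z r X' Y' z' r' : ℝ) :
    fanPhi q ⟨0, fab, fac, fbc, f1⟩ ⟨0, X, y, Z, r⟩ ⟨0, X', Y', z', r'⟩ =
      (1 - q) * (X * (X + y + Z + r) * X' * (X' + Y' + z' + r') + (1 - q) * y * Z * Y' * z') * (fac ^ 2 + fac * f1 + fac * fbc)
      + (1 - q) * (Z * (X + y + Z + r) + (1 - q) * X * y) * Y' * (X' + Y' + z' + r') * (fbc ^ 2 + f1 * fbc + fac * fbc)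
      + fac * fab * ((1 - q) * X * X' * ((X + y + Z + r) * (X' + Y' + z' + r') - (1 - q) * y * z')
          + (1 - q) ^ 2 * Z * (X + y + Z + r) * X' * z' + (1 - q) ^ 2 * y * Z * Y' * z')
      + fab * fbc * ((1 - q) * Z * Y' * ((X + y + Z + r) * (X' + Y' + z' + r') - (1 - q) * y * z')
          + (1 - q) ^ 2 * X * y * Y' * (X' + Y' + z' + r') + (1 - q) ^ 2 * X * (X + y + Z + r) * X' * (X' + Y' + z' + r')) := by
  simp only [fanPhi, hx, hy, hz, V5.total]
  ring

/-- **FFF endpoint of LEMMA′**: `fanPhi ≥ 0` at floor points of the three legs (all coordinates `≥ 0`, `0 ≤ q ≤ 1`). [folklore] -/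
theorem fanPhi_floor_floor_floor_nonneg {q : ℝ} (hq0 : 0 ≤ q) (hq1 : q ≤ 1) {fab fac fbc f1 X y Z r X' Y' z' r' : ℝ}
    (hfab : 0 ≤ fab) (hfac : 0 ≤ fac) (hfbc : 0 ≤ fbc) (hf1 : 0 ≤ f1) (hX : 0 ≤ X) (hy : 0 ≤ y) (hZ : 0 ≤ Z) (hr : 0 ≤ r)
    (hX' : 0 ≤ X') (hY' : 0 ≤ Y') (hz' : 0 ≤ z') (hr' : 0 ≤ r') :
    0 ≤ fanPhi q ⟨0, fab, fac, fbc, f1⟩ ⟨0, X, y, Z, r⟩ ⟨0, X', Y', z', r'⟩ := by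
  rw [fanPhi_floor_floor_floor_eq]
  have hp : 0 ≤ 1 - q := sub_nonneg.2 hq1
  have hV : 0 ≤ X + y + Z + r := by positivity
  have hV' : 0 ≤ X' + Y' + z' + r' := by positivity
  -- the key margin: V V' ≥ y z' ≥ (1−q) y z'
  have hB : 0 ≤ (X + y + Z + r) * (X' + Y' + z' + r') - (1 - q) * y * z' := by
    have h1 : y ≤ X + y + Z + r := by linarith
    have h2 : z' ≤ X' + Y' + z' + r' := by linarith
    have h3 : y * z' ≤ (X + y + Z + r) * (X' + Y' + z' + r') := mul_le_mul h1 h2 hz' hV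
    have h4 : (1 - q) * y * z' ≤ y * z' := by nlinarith [mul_nonneg hy hz']
    linarith
  have t1 : 0 ≤ (1 - q) * (X * (X + y + Z + r) * X' * (X' + Y' + z' + r') + (1 - q) * y * Z * Y' * z') *
      (fac ^ 2 + fac * f1 + fac * fbc) := by positivity
  have t2 : 0 ≤ (1 - q) * (Z * (X + y + Z + r) + (1 - q) * X * y) * Y' * (X' + Y' + z' + r') * (fbc ^ 2 + f1 * fbc + fac * fbc) := by
    positivity
  have t3 : 0 ≤ fac * fab * ((1 - q) * X * X' * ((X + y + Z + r) * (X' + Y' + z' + r') - (1 - q) * y * z')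
      + (1 - q) ^ 2 * Z * (X + y + Z + r) * X' * z' + (1 - q) ^ 2 * y * Z * Y' * z') := by
    apply mul_nonneg (mul_nonneg hfac hfab)
    have : 0 ≤ (1 - q) * X * X' * ((X + y + Z + r) * (X' + Y' + z' + r') - (1 - q) * y * z') :=
      mul_nonneg (by positivity) hB
    positivity
  have t4 : 0 ≤ fab * fbc * ((1 - q) * Z * Y' * ((X + y + Z + r) * (X' + Y' + z' + r') - (1 - q) * y * z')
      + (1 - q) ^ 2 * X * y * Y' * (X' + Y' + z' + r') + (1 - q) ^ 2 * X * (X + y + Z + r) * X' * (X' + Y' + z' + r')) := by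
    apply mul_nonneg (mul_nonneg hfab hfbc)
    have : 0 ≤ (1 - q) * Z * Y' * ((X + y + Z + r) * (X' + Y' + z' + r') - (1 - q) * y * z') :=
      mul_nonneg (by positivity) hB
    positivity
  linarith

end ThreeApex

end FK

end Summit.CriticalPhenomena.PercolationContinuityZ3.Theorems
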